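import Mathlib
import Literature.NumberTheory.LFunctions.Zhang2022.AppendixALocalSeries
import Literature.NumberTheory.LFunctions.Zhang2022.TypedAppendixA2
import Literature.NumberTheory.LFunctions.Zhang2022.TypedAppendixA1Identities
import Literature.NumberTheory.LFunctions.SelbergMollifierProofs
import Literature.NumberTheory.Sieve.CoprimeSquarefreeSumsBounds
import HarnessLib

/-!
# Zhang (2022), Appendix A part 2 (v): preparations for the deduction node `Lem152_pf` — the Euler factor of (A.4) at `d = l = 1`, the per-prime estimate, and the tail of the Euler product of Lemma 15.2

Topic `Literature/NumberTheory/LFunctions/Zhang2022` (Landau–Siegel audit tree; verdict-neutral).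
Y. Zhang, *Discrete mean estimates and the Landau–Siegel zero*, arXiv:2211.02515v1 (2022)
[Zhang2022LandauSiegel] — **an unrefereed manuscript under adjudication**. The cell's typed node
`Typed.AppendixA2.Lem152_pf c′ := EqA4 c′ → EqA5 c′ → StepA_u021 c′ → EqA6 c′ → EqA7 c′ → Lemma152 c′`
(the manuscript's "By (A.4), (A.5) and the relations … it suffices to show (A.6) … and (A.7)", App. A
p. 103) is proved in the companion `AppendixALemma152.lean`; this file supplies the bookkeeping the
manuscript leaves implicit: (o) `calM1Factor(q;1,1;s) = zetaFactor1·(1 + λ₁(q)·sumA6)` EXACTLY from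
(A.5) and u021a (`calM1Factor_one_one_eq`) and the per-prime estimate `‖calM1Factor − M_q‖ ≤
K·α log q/q` from u021b/(A.6)/(A.7) (`norm_calM1Factor_sub_main_le`); (i) the finite product
`∏_{q<D}(M_q + O(α log q/q)) = (∏_{q<D} M_q)(1 + O(α Σ_{q<D} log q/q)) = (∏ M_q)(1 + O(α𝓛))`
(Mertens: `Σ_{p≤D} log p/p ≤ 𝓛 + log 4`, tree `MertensBound.sum_log_div_prime_le`; `|M_q| ≥ 1`,
`∏|M_q| ≤ e^{8/3}`), (ii) the tail of the Euler product `∏_{(q,D)=1}(1−χ(q)q⁻²)/(1−q⁻²)` beyond `D`: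
`∏_{q≥D} = 1 + O(1/D)` (Mathlib `multipliable_one_add_of_summable`, `Finset.norm_prod_one_add_sub_one_le`),
(iii) the absorption of `D^{−c}` and `1/D` into `O(α𝓛) = O(𝓛⁻⁸)` for `D ≥ D₀(c, C, c′)`.

## References

* Y. Zhang, arXiv:2211.02515v1 (2022), Appendix A pp. 103–104; §15 Lemma 15.2 p. 87.
  [cite: Zhang2022LandauSiegel, Appendix A, Lemma 15.2]
* G. H. Hardy, E. M. Wright, *An Introduction to the Theory of Numbers*, Thm 425. [HardyWright2008]
-/

noncomputable section

open Finset Real Complex ArithmeticFunction Filter Topology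

namespace Literature.NumberTheory.LFunctions.Zhang2022.AppendixALocal

open MeanSquareMajorant (powI kappa₁)
open Skeleton (ell alpha bigP b1 b2 beta1 beta2 nset ForAllLarge)
-- OBJECTS: the §15 objects of `Typed.AppendixA2` are the imported `Typed.Section15A/15B/15C` ones
-- (merge revision p414212); `sumA6`, `zetaFactor1` are `Typed.AppendixA2`'s own.
open Typed.Section15A (kappa1 kappaTilde1 lam1)
open Typed.Section15B (xi1 lamTilde1 xi1LocalSeries calM1Factor calM1)
open Typed.Section15C (eulerM1)
open Typed.AppendixA2 (sumA6 zetaFactor1)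

/-! ### §1. Finite products: a perturbation lemma -/

/-- **Finite-product perturbation**: if `‖M_i‖ ≥ 1` and `‖F_i − M_i‖ ≤ e_i` on a finset, then
`‖∏F − ∏M‖ ≤ ‖∏M‖·(exp(Σe) − 1)` (write `F_i = M_i(1 + g_i)`, `|g_i| ≤ e_i`, and use
`‖∏(1+g) − 1‖ ≤ exp(Σ‖g‖) − 1`). (Implicit in "∏_{q<D}(… + O(α log q/q))", App. A p. 103.)
[cite: Zhang2022LandauSiegel, App. A (A.4)–(A.7) p. 103] -/
theorem norm_prod_sub_prod_le {ι : Type*} (S : Finset ι) (F M : ι → ℂ) (e : ι → ℝ)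
    (hM : ∀ i ∈ S, 1 ≤ ‖M i‖) (hFM : ∀ i ∈ S, ‖F i - M i‖ ≤ e i) :
    ‖∏ i ∈ S, F i - ∏ i ∈ S, M i‖ ≤ ‖∏ i ∈ S, M i‖ * (Real.exp (∑ i ∈ S, e i) - 1) := by
  classical
  set g : ι → ℂ := fun i => (F i - M i) / M i with hg
  have hM0 : ∀ i ∈ S, M i ≠ 0 := fun i hi h => by
    have := hM i hi; rw [h, norm_zero] at this; linarith
  have hF : ∀ i ∈ S, F i = M i * (1 + g i) := fun i hi => by
    rw [hg]; field_simp [hM0 i hi]; ring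
  have hprod : ∏ i ∈ S, F i = (∏ i ∈ S, M i) * ∏ i ∈ S, (1 + g i) := by
    rw [← prod_mul_distrib]; exact prod_congr rfl hF
  have hgle : ∀ i ∈ S, ‖g i‖ ≤ e i := fun i hi => by
    rw [hg]
    simp only
    rw [norm_div]
    calc ‖F i - M i‖ / ‖M i‖ ≤ ‖F i - M i‖ / 1 := by
          apply div_le_div_of_nonneg_left (norm_nonneg _) one_pos (hM i hi)
      _ ≤ e i := by rw [div_one]; exact hFM i hi
  rw [hprod, ← mul_sub_one, norm_mul]
  refine mul_le_mul_of_nonneg_left ?_ (norm_nonneg _)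
  calc ‖∏ i ∈ S, (1 + g i) - 1‖ ≤ Real.exp (∑ i ∈ S, ‖g i‖) - 1 :=
        Finset.norm_prod_one_add_sub_one_le S g
    _ ≤ Real.exp (∑ i ∈ S, e i) - 1 := by
        gcongr with i hi
        exact hgle i hi

/-! ### §2. The main factors `M_q` -/

/-- `χ(q) = ±1` for `χ` quadratic and `q` prime to the modulus (a unit of `ZMod D`).
[cite: Zhang2022LandauSiegel, App. A p. 101 ("v = χ(q)")] -/
theorem chi_val_eq_one_or_neg_one {D : ℕ} [NeZero D] (χ : DirichletCharacter ℂ D)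
    (hq2 : χ.IsQuadratic) {q : ℕ} (hcop : Nat.Coprime q D) :
    χ (q : ZMod D) = 1 ∨ χ (q : ZMod D) = -1 := by
  have hunit : IsUnit (q : ZMod D) := (ZMod.isUnit_iff_coprime q D).mpr hcop
  rcases hq2 (q : ZMod D) with h | h | h
  · exfalso
    obtain ⟨w, hw⟩ := hunit
    have := (χ.toUnitHom w).ne_zero
    rw [MulChar.coe_toUnitHom, hw] at this
    exact this h
  · exact Or.inl h
  · exact Or.inr h

/-- The main factor at a prime `q`: `(1 − χ(q)q⁻²)/(1 − q⁻²)` if `(q,D) = 1`, and `1` if not (then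
`q ∣ D` and the factor of Lemma 15.2's Euler product is absent). [cite: Zhang2022LandauSiegel, Lemma 15.2 p. 87] -/
theorem mainFactor_cases {D : ℕ} (χ : DirichletCharacter ℂ D) (q : ℕ) :
    (if Nat.Coprime q D then
        (1 - χ (q : ZMod D) * (q : ℂ)⁻¹ ^ 2) / (1 - (q : ℂ)⁻¹ ^ 2) else (1 : ℂ)) =
      if Nat.Coprime q D then (1 - χ (q : ZMod D) * (q : ℂ)⁻¹ ^ 2) / (1 - (q : ℂ)⁻¹ ^ 2) else 1 :=
  rfl

/-- For `χ(q) = ±1` and a prime `q`: `1 ≤ ‖(1 − χ(q)q⁻²)/(1 − q⁻²)‖ ≤ 1 + 3q⁻²`.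
[cite: Zhang2022LandauSiegel, Lemma 15.2 p. 87] -/
theorem norm_mainFactor_bounds {v : ℂ} (hv : v = 1 ∨ v = -1) {q : ℕ} (hq : q.Prime) :
    1 ≤ ‖(1 - v * (q : ℂ)⁻¹ ^ 2) / (1 - (q : ℂ)⁻¹ ^ 2)‖ ∧
      ‖(1 - v * (q : ℂ)⁻¹ ^ 2) / (1 - (q : ℂ)⁻¹ ^ 2)‖ ≤ 1 + 3 * ((q : ℝ) ^ 2)⁻¹ := by
  have hq2 : (2 : ℝ) ≤ q := by exact_mod_cast hq.two_le
  have hq0 : (0 : ℝ) < q := by linarith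
  set t : ℝ := ((q : ℝ) ^ 2)⁻¹ with ht
  have ht0 : 0 < t := by rw [ht]; positivity
  have ht4 : t ≤ 1 / 4 := by
    rw [ht, ← one_div]
    apply div_le_div_of_nonneg_left zero_le_one (by norm_num)
    nlinarith
  have hcast : ((q : ℂ)⁻¹ ^ 2) = ((t : ℝ) : ℂ) := by
    rw [ht]; push_cast; rw [inv_pow]
  have hden : (1 : ℂ) - (q : ℂ)⁻¹ ^ 2 = (((1 - t : ℝ)) : ℂ) := by rw [hcast]; push_cast; ring
  have hden0 : (0 : ℝ) < 1 - t := by linarith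
  rcases hv with rfl | rfl
  · -- `v = 1`: the factor is `1`
    have : (1 - 1 * (q : ℂ)⁻¹ ^ 2) / (1 - (q : ℂ)⁻¹ ^ 2) = 1 := by
      rw [one_mul, div_self]
      rw [hden]; exact_mod_cast hden0.ne'
    rw [this, norm_one]
    exact ⟨le_rfl, by linarith⟩
  · -- `v = −1`: the factor is `(1 + t)/(1 − t)`
    have : (1 - (-1) * (q : ℂ)⁻¹ ^ 2) / (1 - (q : ℂ)⁻¹ ^ 2) = (((1 + t) / (1 - t) : ℝ) : ℂ) := by
      rw [hden, hcast]; push_cast; ring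
    rw [this, Complex.norm_real, Real.norm_eq_abs, abs_of_pos (div_pos (by linarith) hden0)]
    constructor
    · rw [le_div_iff₀ hden0]; linarith
    · rw [div_le_iff₀ hden0]; nlinarith

/-- **`∏_{q<D, q prime} (1 + 3q⁻²) ≤ e³`** (`Σ_{q≥2} q⁻² ≤ 1`). [cite: Zhang2022LandauSiegel, Lemma 15.2 p. 87] -/
theorem prod_one_add_three_div_sq_le (D : ℕ) :
    ∏ q ∈ (Finset.range D).filter Nat.Prime, (1 + 3 * ((q : ℝ) ^ 2)⁻¹) ≤ Real.exp 3 := by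
  have h1 : ∏ q ∈ (Finset.range D).filter Nat.Prime, (1 + 3 * ((q : ℝ) ^ 2)⁻¹) ≤
      Real.exp (∑ q ∈ (Finset.range D).filter Nat.Prime, 3 * ((q : ℝ) ^ 2)⁻¹) :=
    Real.prod_one_add_le_exp_sum _ (fun q => by positivity)
  refine h1.trans (Real.exp_le_exp.mpr ?_)
  have hsub : (Finset.range D).filter Nat.Prime ⊆ Finset.Ico 2 D := by
    intro q hq
    rw [mem_filter, mem_range] at hq
    rw [mem_Ico]; exact ⟨hq.2.two_le, hq.1⟩
  calc ∑ q ∈ (Finset.range D).filter Nat.Prime, 3 * ((q : ℝ) ^ 2)⁻¹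
      ≤ ∑ n ∈ Finset.Ico 2 D, 3 * ((n : ℝ) ^ 2)⁻¹ :=
        sum_le_sum_of_subset_of_nonneg hsub (fun n _ _ => by positivity)
    _ = 3 * ∑ n ∈ Finset.Ico 2 D, ((n : ℝ) ^ 2)⁻¹ := by rw [mul_sum]
    _ ≤ 3 * 1 := by gcongr; exact SelbergMollifier.sum_Ico_two_inv_sq_le_one D
    _ = 3 := by ring

/-! ### §3. `calM1Factor` at `d = l = 1` (the exact rewriting "By (A.5) and λ̃₁(qʳ,1) = λ₁(q)") -/

/-- **"By (A.5) and `λ̃₁(qʳ,1) = λ₁(q)`"** (App. A p. 103): at `d = l = 1` the Euler factor of (A.4) is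
`zetaFactor1 · (1 + λ₁(q)·sumA6)` EXACTLY. [cite: Zhang2022LandauSiegel, App. A p. 103 (proof of Lemma 15.2)] -/
theorem calM1Factor_one_one_eq (c' : ℝ) {D : ℕ} [NeZero D] (χ : DirichletCharacter ℂ D)
    (h5D : ∀ q r : ℕ, q.Prime → 1 ≤ r → xi1 c' χ (q ^ r) 1 1 =
      kappaTilde1 c' χ (q ^ r) 1 1 - χ (q : ZMod D) * (q : ℂ) / ((q : ℂ) - 1) * kappa1 c' D (q ^ (r - 1)))
    (h21aD : ∀ q : ℕ, q.Prime → lamTilde1 c' χ q 1 = lam1 c' χ q 1)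
    {q : ℕ} (hq : q.Prime) (s : ℂ) :
    calM1Factor c' χ q 1 1 s = zetaFactor1 c' χ q s * (1 + lam1 c' χ q 1 * sumA6 c' χ q s) := by
  have hlt : lamTilde1 c' χ q 1 = lam1 c' χ q 1 := h21aD q hq
  have hxi : xi1LocalSeries c' χ q 1 1 s = sumA6 c' χ q s := by
    rw [xi1LocalSeries, sumA6]
    refine tsum_congr fun r => ?_
    by_cases hr : r = 0
    · simp [hr]
    · rw [if_neg hr, if_neg hr, h5D q r hq (Nat.one_le_iff_ne_zero.mpr hr)]
  rw [calM1Factor, zetaFactor1, hlt, hxi]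

/-! ### §4. The per-prime estimate -/

/-- Products of two approximations: `‖ZF·T − Z₀T₀‖ ≤ 5a + ab + 3b` when `‖ZF − Z₀‖ ≤ a`, `‖T − T₀‖ ≤ b`,
`‖Z₀‖ ≤ 3`, `‖T₀‖ ≤ 5`. [cite: Zhang2022LandauSiegel, App. A p. 103] -/
theorem norm_mul_sub_mul_le_of {ZF Z₀ T T₀ : ℂ} {a b : ℝ} (hZ : ‖ZF - Z₀‖ ≤ a) (hT : ‖T - T₀‖ ≤ b)
    (hZ₀ : ‖Z₀‖ ≤ 3) (hT₀ : ‖T₀‖ ≤ 5) : ‖ZF * T - Z₀ * T₀‖ ≤ 5 * a + a * b + 3 * b := by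
  have ha : 0 ≤ a := le_trans (norm_nonneg _) hZ
  have hb : 0 ≤ b := le_trans (norm_nonneg _) hT
  have e : ZF * T - Z₀ * T₀ = (ZF - Z₀) * T₀ + (ZF - Z₀) * (T - T₀) + Z₀ * (T - T₀) := by ring
  rw [e]
  calc _ ≤ ‖(ZF - Z₀) * T₀ + (ZF - Z₀) * (T - T₀)‖ + ‖Z₀ * (T - T₀)‖ := norm_add_le _ _
    _ ≤ ‖(ZF - Z₀) * T₀‖ + ‖(ZF - Z₀) * (T - T₀)‖ + ‖Z₀ * (T - T₀)‖ := by
        gcongr; exact norm_add_le _ _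
    _ = ‖ZF - Z₀‖ * ‖T₀‖ + ‖ZF - Z₀‖ * ‖T - T₀‖ + ‖Z₀‖ * ‖T - T₀‖ := by
        rw [norm_mul, norm_mul, norm_mul]
    _ ≤ a * 5 + a * b + 3 * b := by gcongr
    _ = 5 * a + a * b + 3 * b := by ring

/-- **The Euler factor of (A.4) at `d = l = 1`, per prime**: for `D ≥ D₀`, a prime `q < D` and
`|s − 1| < 5α`, given the u021b / (A.6) / (A.7) bounds with constants `C₁, C₂ ≥ 1` at this `q`,
`‖calM1Factor(q;1,1;s) − M_q‖ ≤ (5C₁ + C₁C₂ + 3C₂)·α log q/q` where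
`M_q = (1 − χ(q)q⁻²)/(1 − q⁻²)` if `(q,D) = 1` and `M_q = 1` if `q ∣ D`.
[cite: Zhang2022LandauSiegel, App. A pp. 103–104 (proof of Lemma 15.2)] -/
theorem norm_calM1Factor_sub_main_le (c' : ℝ) {D : ℕ} [NeZero D] (χ : DirichletCharacter ℂ D)
    (h5D : ∀ q r : ℕ, q.Prime → 1 ≤ r → xi1 c' χ (q ^ r) 1 1 =
      kappaTilde1 c' χ (q ^ r) 1 1 - χ (q : ZMod D) * (q : ℂ) / ((q : ℂ) - 1) * kappa1 c' D (q ^ (r - 1)))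
    (h21aD : ∀ q : ℕ, q.Prime → lamTilde1 c' χ q 1 = lam1 c' χ q 1)
    {q : ℕ} (hq : q.Prime) {s : ℂ} {C₁ C₂ : ℝ} (hC₁ : 1 ≤ C₁) (hC₂ : 1 ≤ C₂)
    (hε : alpha D * Real.log q / q ≤ 1) (hα : 0 ≤ alpha D)
    (hZF : ‖zetaFactor1 c' χ q s - (1 - (q : ℂ)⁻¹) / (1 - χ (q : ZMod D) * (q : ℂ)⁻¹)‖ ≤
      C₁ * (alpha D * Real.log q / q))
    (h6 : Nat.Coprime q D → ‖1 + lam1 c' χ q 1 * sumA6 c' χ q s -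
        (1 - χ (q : ZMod D) * (q : ℂ)⁻¹) / (1 - (q : ℂ)⁻¹) *
          ((1 - χ (q : ZMod D) * (q : ℂ)⁻¹ ^ 2) / (1 - (q : ℂ)⁻¹ ^ 2))‖ ≤
      C₂ * (alpha D * Real.log q / q))
    (h7 : q ∣ D → ‖1 + lam1 c' χ q 1 * sumA6 c' χ q s - 1 / (1 - (q : ℂ)⁻¹)‖ ≤
      C₂ * (alpha D * Real.log q / q)) :
    ‖calM1Factor c' χ q 1 1 s -
        (if Nat.Coprime q D then (1 - χ (q : ZMod D) * (q : ℂ)⁻¹ ^ 2) / (1 - (q : ℂ)⁻¹ ^ 2) else 1)‖ ≤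
      (5 * C₁ + C₁ * C₂ + 3 * C₂) * (alpha D * Real.log q / q) := by
  set ε : ℝ := alpha D * Real.log q / q with hε_def
  have hε0 : 0 ≤ ε := by rw [hε_def]; exact div_nonneg (mul_nonneg hα (Real.log_natCast_nonneg q)) (Nat.cast_nonneg q)
  have hv : ‖χ (q : ZMod D)‖ ≤ 1 := χ.norm_le_one _
  have hu : ‖(q : ℂ)⁻¹‖ ≤ 1 / 2 := norm_inv_natCast_le_half hq.two_le
  set u : ℂ := (q : ℂ)⁻¹ with hu_def
  set v : ℂ := χ (q : ZMod D) with hv_def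
  have h1u : (1 : ℂ) - u ≠ 0 := by
    have h := one_sub_ne_zero hu (v := 1) (by simp); simpa using h
  have h1vu : (1 : ℂ) - v * u ≠ 0 := one_sub_ne_zero hu hv
  have hZ₀ : ‖(1 - u) / (1 - v * u)‖ ≤ 3 := by
    have hden := half_le_norm_one_sub hu hv
    rw [norm_div]
    calc ‖(1 : ℂ) - u‖ / ‖1 - v * u‖ ≤ (3 / 2) / (1 / 2) := by
          gcongr
          calc ‖(1 : ℂ) - u‖ ≤ ‖(1 : ℂ)‖ + ‖u‖ := norm_sub_le _ _
            _ ≤ 1 + 1 / 2 := by rw [norm_one]; gcongr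
            _ = 3 / 2 := by norm_num
      _ = 3 := by norm_num
  rw [calM1Factor_one_one_eq c' χ h5D h21aD hq s]
  have hmain : ∀ {T₀ M : ℂ}, ‖T₀‖ ≤ 5 → (1 - u) / (1 - v * u) * T₀ = M →
      ‖1 + lam1 c' χ q 1 * sumA6 c' χ q s - T₀‖ ≤ C₂ * ε →
      ‖zetaFactor1 c' χ q s * (1 + lam1 c' χ q 1 * sumA6 c' χ q s) - M‖ ≤
        (5 * C₁ + C₁ * C₂ + 3 * C₂) * ε := by
    intro T₀ M hT₀ hM hT
    rw [← hM]
    calc _ ≤ 5 * (C₁ * ε) + (C₁ * ε) * (C₂ * ε) + 3 * (C₂ * ε) :=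
          norm_mul_sub_mul_le_of hZF hT hZ₀ hT₀
      _ ≤ 5 * (C₁ * ε) + (C₁ * ε) * (C₂ * 1) + 3 * (C₂ * ε) := by gcongr
      _ = (5 * C₁ + C₁ * C₂ + 3 * C₂) * ε := by ring
  by_cases hcop : Nat.Coprime q D
  · rw [if_pos hcop]
    refine hmain ?_ ?_ (h6 hcop)
    · -- ‖T₀‖ ≤ 5
      rw [norm_mul, norm_div, norm_div]
      have hden1 : (1 : ℝ) / 2 ≤ ‖(1 : ℂ) - u‖ := by
        have := norm_sub_norm_le (1 : ℂ) u; rw [norm_one] at this; linarith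
      have hu2 : ‖u ^ 2‖ ≤ 1 / 4 := by
        rw [norm_pow]; nlinarith [norm_nonneg u]
      have hden2 : (3 : ℝ) / 4 ≤ ‖(1 : ℂ) - u ^ 2‖ := by
        have := norm_sub_norm_le (1 : ℂ) (u ^ 2); rw [norm_one] at this; linarith
      have hn1 : ‖(1 : ℂ) - v * u‖ ≤ 3 / 2 := by
        calc _ ≤ ‖(1 : ℂ)‖ + ‖v * u‖ := norm_sub_le _ _
          _ ≤ 1 + 1 * (1 / 2) := by rw [norm_one, norm_mul]; gcongr
          _ = 3 / 2 := by norm_num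
      have hn2 : ‖(1 : ℂ) - v * u ^ 2‖ ≤ 5 / 4 := by
        calc _ ≤ ‖(1 : ℂ)‖ + ‖v * u ^ 2‖ := norm_sub_le _ _
          _ ≤ 1 + 1 * (1 / 4) := by rw [norm_one, norm_mul]; gcongr
          _ = 5 / 4 := by norm_num
      calc ‖(1 : ℂ) - v * u‖ / ‖(1 : ℂ) - u‖ * (‖(1 : ℂ) - v * u ^ 2‖ / ‖(1 : ℂ) - u ^ 2‖)
          ≤ (3 / 2) / (1 / 2) * ((5 / 4) / (3 / 4)) := by gcongr
        _ = 5 := by norm_num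
    · rw [← mul_assoc, div_mul_div_comm, mul_comm (1 - u) (1 - v * u),
        div_self (mul_ne_zero h1vu h1u), one_mul]
  · rw [if_neg hcop]
    have hdvd : q ∣ D := by
      by_contra hnd
      exact hcop ((Nat.Prime.coprime_iff_not_dvd hq).mpr hnd)
    have hv0 : v = 0 := Typed.AppendixA1.chi_eq_zero_of_dvd χ hq hdvd
    refine hmain (T₀ := 1 / (1 - u)) ?_ ?_ (h7 hdvd)
    · rw [norm_div, norm_one]
      have hden1 : (1 : ℝ) / 2 ≤ ‖(1 : ℂ) - u‖ := by
        have := norm_sub_norm_le (1 : ℂ) u; rw [norm_one] at this; linarith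
      calc 1 / ‖(1 : ℂ) - u‖ ≤ 1 / (1 / 2) := by gcongr
        _ ≤ 5 := by norm_num
    · rw [hv0, zero_mul, sub_zero, div_one, mul_one_div, div_self h1u]

/-! ### §5. The main factors: size, and the tail of the Euler product `eulerM1` -/

/-- `1 ≤ ‖M_q‖ ≤ 1 + 3q⁻²` for the main factor at a prime `q` (quadratic `χ`).
[cite: Zhang2022LandauSiegel, Lemma 15.2 p. 87] -/
theorem norm_main_bounds {D : ℕ} [NeZero D] (χ : DirichletCharacter ℂ D) (hquad : χ.IsQuadratic)
    {q : ℕ} (hq : q.Prime) :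
    1 ≤ ‖(if Nat.Coprime q D then (1 - χ (q : ZMod D) * (q : ℂ)⁻¹ ^ 2) / (1 - (q : ℂ)⁻¹ ^ 2)
        else (1 : ℂ))‖ ∧
    ‖(if Nat.Coprime q D then (1 - χ (q : ZMod D) * (q : ℂ)⁻¹ ^ 2) / (1 - (q : ℂ)⁻¹ ^ 2)
        else (1 : ℂ))‖ ≤ 1 + 3 * ((q : ℝ) ^ 2)⁻¹ := by
  by_cases hcop : Nat.Coprime q D
  · rw [if_pos hcop]
    exact norm_mainFactor_bounds (chi_val_eq_one_or_neg_one χ hquad hcop) hq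
  · rw [if_neg hcop, norm_one]
    refine ⟨le_rfl, ?_⟩
    have : (0:ℝ) ≤ 3 * ((q : ℝ) ^ 2)⁻¹ := by positivity
    linarith

/-- `‖∏_{q<D} M_q‖ ≤ e³`. [cite: Zhang2022LandauSiegel, Lemma 15.2 p. 87] -/
theorem norm_prod_main_le {D : ℕ} [NeZero D] (χ : DirichletCharacter ℂ D) (hquad : χ.IsQuadratic) :
    ‖∏ q ∈ (Finset.range D).filter Nat.Prime,
        (if Nat.Coprime q D then (1 - χ (q : ZMod D) * (q : ℂ)⁻¹ ^ 2) / (1 - (q : ℂ)⁻¹ ^ 2)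
          else (1 : ℂ))‖ ≤ Real.exp 3 := by
  rw [norm_prod]
  calc _ ≤ ∏ q ∈ (Finset.range D).filter Nat.Prime, (1 + 3 * ((q : ℝ) ^ 2)⁻¹) := by
        refine prod_le_prod (fun q _ => norm_nonneg _) fun q hq => ?_
        exact (norm_main_bounds χ hquad (mem_filter.mp hq).2).2
    _ ≤ Real.exp 3 := prod_one_add_three_div_sq_le D

/-- Telescoping from `a`: `Σ_{a≤n<N} (1/(n−1) − 1/n) = 1/(a−1) − 1/(N−1)` (`a ≤ N`; for `a ≤ 1` both sides carry
Lean's junk value `0⁻¹ = 0` consistently). [cite: Zhang2022LandauSiegel, Lemma 15.2 p. 87] -/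
theorem sum_Ico_inv_sub_inv' {a N : ℕ} (hN : a ≤ N) :
    ∑ n ∈ Finset.Ico a N, (((n : ℝ) - 1)⁻¹ - ((n : ℝ))⁻¹) = ((a : ℝ) - 1)⁻¹ - ((N : ℝ) - 1)⁻¹ := by
  induction N, hN using Nat.le_induction with
  | base => simp
  | succ M hM ih =>
    rw [sum_Ico_succ_top hM, ih]
    push_cast
    ring

/-- The tail over a finite set of integers `≥ D ≥ 2`: `Σ_{n∈U} 2/(n²−1)·… ≤` — concretely
`Σ_{n∈U} 2(1/(n−1) − 1/n) ≤ 2/(D−1)`. [cite: Zhang2022LandauSiegel, Lemma 15.2 p. 87] -/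
theorem sum_tail_le (U : Finset ℕ) {D : ℕ} (hD : 2 ≤ D) (hU : ∀ n ∈ U, D ≤ n) :
    ∑ n ∈ U, 2 * (((n : ℝ) - 1)⁻¹ - ((n : ℝ))⁻¹) ≤ 2 / ((D : ℝ) - 1) := by
  have hD2 : (2:ℝ) ≤ D := by exact_mod_cast hD
  rcases U.eq_empty_or_nonempty with rfl | hne
  · rw [sum_empty]; exact div_nonneg (by norm_num) (by linarith)
  set N := U.max' hne with hN
  have hsub : U ⊆ Finset.Ico D (N + 1) := by
    intro n hn
    rw [mem_Ico]
    exact ⟨hU n hn, Nat.lt_succ_of_le (U.le_max' n hn)⟩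
  have hDN : D ≤ N + 1 := le_trans (hU _ (U.max'_mem hne)) (Nat.le_succ _)
  have hnonneg : ∀ n ∈ Finset.Ico D (N + 1), 0 ≤ 2 * (((n : ℝ) - 1)⁻¹ - ((n : ℝ))⁻¹) := by
    intro n hn
    rw [mem_Ico] at hn
    have h2 : (2 : ℝ) ≤ n := by exact_mod_cast le_trans hD hn.1
    have : ((n : ℝ))⁻¹ ≤ ((n : ℝ) - 1)⁻¹ := by
      apply inv_anti₀ (by linarith) (by linarith)
    linarith
  calc ∑ n ∈ U, 2 * (((n : ℝ) - 1)⁻¹ - ((n : ℝ))⁻¹)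
      ≤ ∑ n ∈ Finset.Ico D (N + 1), 2 * (((n : ℝ) - 1)⁻¹ - ((n : ℝ))⁻¹) :=
        sum_le_sum_of_subset_of_nonneg hsub (fun n hn _ => hnonneg n hn)
    _ = 2 * (((D : ℝ) - 1)⁻¹ - (((N + 1 : ℕ) : ℝ) - 1)⁻¹) := by
        rw [← mul_sum, sum_Ico_inv_sub_inv' hDN]
    _ ≤ 2 / ((D : ℝ) - 1) := by
        have : (0 : ℝ) ≤ (((N + 1 : ℕ) : ℝ) - 1)⁻¹ := by
          push_cast; exact inv_nonneg.mpr (by simp)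
        rw [div_eq_mul_inv]; linarith

/-- The Euler factor of `eulerM1` as a function on `ℕ` (`1` off the primes coprime to `D`).
[cite: Zhang2022LandauSiegel, Lemma 15.2 p. 87] -/
theorem eulerM1_eq_tprod {D : ℕ} (χ : DirichletCharacter ℂ D) :
    eulerM1 χ = ∏' p : Nat.Primes, (fun n : ℕ => if Nat.Coprime n D then
      (1 - χ (n : ZMod D) / (n : ℂ) ^ 2) / (1 - 1 / (n : ℂ) ^ 2) else (1 : ℂ)) p := rfl

/-- The literal factor of `eulerM1` equals the main factor `M_q` (`χ(q)/q² = χ(q)(q⁻¹)²`, `1/q² = (q⁻¹)²`).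
[cite: Zhang2022LandauSiegel, Lemma 15.2 p. 87] -/
theorem eulerFactor_eq_main {D : ℕ} (χ : DirichletCharacter ℂ D) (n : ℕ) :
    (if Nat.Coprime n D then (1 - χ (n : ZMod D) / (n : ℂ) ^ 2) / (1 - 1 / (n : ℂ) ^ 2) else (1 : ℂ)) =
      if Nat.Coprime n D then (1 - χ (n : ZMod D) * (n : ℂ)⁻¹ ^ 2) / (1 - (n : ℂ)⁻¹ ^ 2) else 1 := by
  by_cases h : Nat.Coprime n D
  · rw [if_pos h, if_pos h, div_eq_mul_inv (χ _), one_div, inv_pow]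
  · rw [if_neg h, if_neg h]

/-- `‖M_q − 1‖ ≤ 2(1/(q−1) − 1/q)` at a prime `q` (quadratic `χ`): `M_q − 1 = (1−χ(q))/(q²−1)` or `0`.
[cite: Zhang2022LandauSiegel, Lemma 15.2 p. 87] -/
theorem norm_main_sub_one_le {D : ℕ} [NeZero D] (χ : DirichletCharacter ℂ D) {q : ℕ} (hq : q.Prime) :
    ‖(if Nat.Coprime q D then (1 - χ (q : ZMod D) * (q : ℂ)⁻¹ ^ 2) / (1 - (q : ℂ)⁻¹ ^ 2)
        else (1 : ℂ)) - 1‖ ≤ 2 * ((((q : ℕ) : ℝ) - 1)⁻¹ - (((q : ℕ) : ℝ))⁻¹) := by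
  have hq2 : (2 : ℝ) ≤ q := by exact_mod_cast hq.two_le
  have hq0 : (q : ℂ) ≠ 0 := by exact_mod_cast hq.ne_zero
  have htel : (((q : ℕ) : ℝ) - 1)⁻¹ - (((q : ℕ) : ℝ))⁻¹ = 1 / (((q:ℝ) - 1) * q) := by
    rw [inv_sub_inv (by linarith) (by linarith)]; ring
  by_cases hcop : Nat.Coprime q D
  · rw [if_pos hcop]
    have hv : ‖χ (q : ZMod D)‖ ≤ 1 := χ.norm_le_one _
    have hden : (1 : ℂ) - (q : ℂ)⁻¹ ^ 2 ≠ 0 := by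
      rw [sub_ne_zero, ne_comm, ne_eq, inv_pow, inv_eq_one]
      intro h
      have : ((q : ℂ)) ^ 2 = ((q ^ 2 : ℕ) : ℂ) := by push_cast; ring
      rw [this, Nat.cast_eq_one] at h
      nlinarith [hq.two_le]
    have e : (1 - χ (q : ZMod D) * (q : ℂ)⁻¹ ^ 2) / (1 - (q : ℂ)⁻¹ ^ 2) - 1 =
        (1 - χ (q : ZMod D)) / ((q : ℂ) ^ 2 - 1) := by
      rw [div_sub_one hden, inv_pow]
      field_simp
      ring
    rw [e, norm_div]
    have hq2c : ‖(q : ℂ) ^ 2 - 1‖ = (q : ℝ) ^ 2 - 1 := by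
      have : (q : ℂ) ^ 2 - 1 = (((q : ℝ) ^ 2 - 1 : ℝ) : ℂ) := by push_cast; ring
      rw [this, Complex.norm_real, Real.norm_eq_abs, abs_of_pos (by nlinarith)]
    rw [hq2c, htel]
    have hnum : ‖(1 : ℂ) - χ (q : ZMod D)‖ ≤ 2 := by
      calc _ ≤ ‖(1 : ℂ)‖ + ‖χ (q : ZMod D)‖ := norm_sub_le _ _
        _ ≤ 1 + 1 := by rw [norm_one]; gcongr
        _ = 2 := by norm_num
    rw [div_le_iff₀ (by nlinarith)]
    have h1 : 0 < (q : ℝ) - 1 := by linarith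
    have hq0r : (0 : ℝ) < q := by linarith
    have hre : 2 * (1 / (((q : ℝ) - 1) * q)) * ((q : ℝ) ^ 2 - 1) = 2 * ((q : ℝ) + 1) / q := by
      field_simp
      ring
    calc ‖(1 : ℂ) - χ (q : ZMod D)‖ ≤ 2 := hnum
      _ ≤ 2 * ((q : ℝ) + 1) / q := by rw [le_div_iff₀ hq0r]; nlinarith
      _ = 2 * (1 / (((q : ℝ) - 1) * q)) * ((q : ℝ) ^ 2 - 1) := hre.symm
  · rw [if_neg hcop, sub_self, norm_zero, htel]
    exact mul_nonneg (by norm_num) (div_nonneg zero_le_one (mul_nonneg (by linarith) (by linarith)))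

/-- **The tail of the Euler product of Lemma 15.2**: for `D ≥ 3`,
`‖eulerM1 − ∏_{q<D} M_q‖ ≤ ‖∏_{q<D} M_q‖ · (exp(2/(D−1)) − 1)`
(`eulerM1 = ∏'_{p} (…)`, Mathlib's `multipliable_one_add_of_summable` and
`Finset.norm_prod_one_add_sub_one_le`). [cite: Zhang2022LandauSiegel, Lemma 15.2 p. 87] -/
theorem norm_eulerM1_sub_prod_le {D : ℕ} [NeZero D] (χ : DirichletCharacter ℂ D) (hD : 2 ≤ D) :
    ‖eulerM1 χ - ∏ q ∈ (Finset.range D).filter Nat.Prime,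
        (if Nat.Coprime q D then (1 - χ (q : ZMod D) * (q : ℂ)⁻¹ ^ 2) / (1 - (q : ℂ)⁻¹ ^ 2)
          else (1 : ℂ))‖ ≤
      ‖∏ q ∈ (Finset.range D).filter Nat.Prime,
        (if Nat.Coprime q D then (1 - χ (q : ZMod D) * (q : ℂ)⁻¹ ^ 2) / (1 - (q : ℂ)⁻¹ ^ 2)
          else (1 : ℂ))‖ * (Real.exp (2 / ((D : ℝ) - 1)) - 1) := by
  classical
  -- the factor as a function on `ℕ`, and its deviation from `1`
  set M : ℕ → ℂ := fun n => if Nat.Coprime n D then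
      (1 - χ (n : ZMod D) * (n : ℂ)⁻¹ ^ 2) / (1 - (n : ℂ)⁻¹ ^ 2) else 1 with hM
  set g : Nat.Primes → ℂ := fun p => M p - 1 with hg
  have hF : (fun p : Nat.Primes => M p) = fun p => 1 + g p := by
    ext p; rw [hg]; ring
  -- summability of `‖g‖` via `2/(p(p−1))`-type bound ≤ 4/p²... we use `‖g p‖ ≤ 4 * (p^2)⁻¹`
  have hg_le : ∀ p : Nat.Primes, ‖g p‖ ≤ 4 * (((p : ℕ) : ℝ) ^ 2)⁻¹ := by
    intro p
    have hp := p.2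
    have hq2 : (2 : ℝ) ≤ (p : ℕ) := by exact_mod_cast hp.two_le
    have h := norm_main_sub_one_le χ hp
    rw [hg]
    calc ‖M p - 1‖ ≤ 2 * ((((p : ℕ) : ℝ) - 1)⁻¹ - (((p : ℕ) : ℝ))⁻¹) := h
      _ ≤ 4 * (((p : ℕ) : ℝ) ^ 2)⁻¹ := by
          rw [inv_sub_inv (by linarith) (by linarith)]
          rw [show (((p:ℕ):ℝ) - (((p:ℕ):ℝ) - 1)) = 1 by ring]
          rw [div_eq_mul_inv, one_mul, ← one_div, ← one_div]
          rw [mul_one_div, mul_one_div, div_le_div_iff₀ (by nlinarith) (by positivity)]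
          nlinarith
  have hsum : Summable (fun p : Nat.Primes => 4 * (((p : ℕ) : ℝ) ^ 2)⁻¹) := by
    have h1 : Summable (fun n : ℕ => ((n : ℝ) ^ 2)⁻¹) := Real.summable_nat_pow_inv.mpr one_lt_two
    exact ((h1.comp_injective Nat.Primes.coe_nat_injective).mul_left 4)
  have hgs : Summable (fun p : Nat.Primes => ‖g p‖) := Summable.of_norm_bounded hsum
    (fun p => by rw [Real.norm_eq_abs, abs_of_nonneg (norm_nonneg _)]; exact hg_le p)
  have hmult : Multipliable (fun p : Nat.Primes => M p) := by
    rw [hF]; exact multipliable_one_add_of_summable hgs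
  have hprod : HasProd (fun p : Nat.Primes => M p) (eulerM1 χ) := by
    have e : eulerM1 χ = ∏' p : Nat.Primes, M p := by
      rw [eulerM1_eq_tprod]; exact tprod_congr fun p => eulerFactor_eq_main χ p
    rw [e]; exact hmult.hasProd
  -- the finite part
  set S : Finset Nat.Primes := (Finset.range D).subtype Nat.Prime with hS
  have hPS : ∏ p ∈ S, M p = ∏ q ∈ (Finset.range D).filter Nat.Prime, M q := by
    rw [hS]; exact prod_subtype_eq_prod_filter (s := Finset.range D) (p := Nat.Prime) M
  -- eventual bound along `atTop`
  have hev : ∀ᶠ T : Finset Nat.Primes in atTop,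
      ‖∏ p ∈ T, M p - ∏ p ∈ S, M p‖ ≤ ‖∏ p ∈ S, M p‖ * (Real.exp (2 / ((D : ℝ) - 1)) - 1) := by
    filter_upwards [eventually_ge_atTop S] with T hT
    rw [← prod_sdiff hT, mul_comm, ← mul_sub_one, norm_mul]
    refine mul_le_mul_of_nonneg_left ?_ (norm_nonneg _)
    have h1 : ∏ p ∈ T \ S, M p = ∏ p ∈ T \ S, (1 + g p) := prod_congr rfl fun p _ => by
      rw [hg]; ring
    rw [h1]
    refine (Finset.norm_prod_one_add_sub_one_le _ _).trans ?_
    gcongr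
    -- `Σ_{p ∈ T \ S} ‖g p‖ ≤ 2/(D−1)`
    have hge : ∀ p ∈ T \ S, D ≤ (p : ℕ) := by
      intro p hp
      rw [Finset.mem_sdiff] at hp
      by_contra hlt
      apply hp.2
      rw [hS]
      exact Finset.mem_subtype.mpr (Finset.mem_range.mpr (not_le.mp hlt))
    calc ∑ p ∈ T \ S, ‖g p‖ ≤ ∑ p ∈ T \ S, 2 * ((((p : ℕ) : ℝ) - 1)⁻¹ - (((p : ℕ) : ℝ))⁻¹) :=
          sum_le_sum fun p _ => norm_main_sub_one_le χ p.2
      _ = ∑ n ∈ (T \ S).map ⟨((↑) : Nat.Primes → ℕ), Nat.Primes.coe_nat_injective⟩,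
            2 * (((n : ℝ) - 1)⁻¹ - ((n : ℝ))⁻¹) := by rw [sum_map]; rfl
      _ ≤ 2 / ((D : ℝ) - 1) := by
          apply sum_tail_le _ hD
          intro n hn
          rw [Finset.mem_map] at hn
          obtain ⟨p, hp, rfl⟩ := hn
          exact hge p hp
  have hlim : Tendsto (fun T : Finset Nat.Primes => ‖∏ p ∈ T, M p - ∏ p ∈ S, M p‖) atTop
      (𝓝 ‖eulerM1 χ - ∏ p ∈ S, M p‖) := by
    have h : Tendsto (fun T : Finset Nat.Primes => ∏ p ∈ T, M p) atTop (𝓝 (eulerM1 χ)) := hprod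
    exact (h.sub_const _).norm
  have := le_of_tendsto hlim hev
  rw [hPS] at this
  exact this

end Literature.NumberTheory.LFunctions.Zhang2022.AppendixALocal
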